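import Summits.QuantumFields.YangMills.Theorems.ColdStartUniversalityLatticeLangevinCarreProduct
import Summits.QuantumFields.YangMills.Theorems.ColdStartUniversalityLatticeLangevinMacroscopicMixing
import HarnessLib

/-!
# Route `ColdStartUniversality` (fixed-cut-off package): LOOP STRINGS — volume-independent cold-start equilibration of PRODUCTS of spatially
# averaged Wilson loops for the SU(2) SZZ dynamics on `(ℤ/L)³` at `|β'| < 1/12`

Helper file (seat `ym-line-csu-p1`, g28; `--supports stmt-QuantumFields-24809`).  The crux `UniformColdStartMixing` tests products `∏_(C∈os)` of
averaged loop observables; this is the fixed-cut-off, torus-averaged counterpart.  For a finite family of rectangular loops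
`(i_k, j_k, R_k × T_k)_(k < m)` put `W̄_k = (L³)⁻¹ Σ_x W_(R_k×T_k)(x; i_k, j_k)` (each `|W̄_k| ≤ 1`):
* `abs_wilsonLoop_two_le_one`, `abs_loopAverage_le_one` — `|W| ≤ 1`, `|W̄| ≤ 1` for `SU(2)`;
* ★★ `wilson_loopString_carre_le` — `Γ(∏_k W̄_k) ≤ 96·(Σ_k (R_k+T_k))²/#sites` (product rule `carre_prod_le` + g27's `wilson_loopAverage_carre_le`);
* ★★★ `wilson_coldStart_loopString_le_exp_explicit` / `_le_volumeFree` — for every deterministic start, every solution, `u ≥ 0`: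
  `|E ∏_k W̄_k(U_(2+u)) − ∫ ∏_k W̄_k dμ_(β')| ≤ e^(−ρu)·√(96(Σ_k(R_k+T_k))²·B_L/(#sites·ρ)) ≤ 57·(Σ_k(R_k+T_k))·e^(−ρu)/√ρ` (`ρ = 1 − 12|β'|`);
* ★★★ `wilson_coldStart_loopString_mixingTime_volumeFree` — `u ≥ log(57Σ_k(R_k+T_k)/(ε√ρ))/ρ ⇒ ≤ ε`: loop strings equilibrate in
  VOLUME-INDEPENDENT time.
[cite: ShenZhuZhu2022, §4 Theorem 4.2, Corollary 4.4]  HONEST FRAMING: FIXED cut-off and fixed `|β'| < 1/12`; torus-wide `Re tr` averages, not the crux's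
block averages `avgObs`; 24809 ASIDE not restated; nothing K-uniform; no crux, rung or summit statement is proved; the Yang–Mills mass gap is NOT proved.
THEOREMS ONLY, no definition, no sorry.
-/

set_option autoImplicit false

noncomputable section

namespace Summit.QuantumFields.YangMills.Theorems.ColdStartUniversality

open MeasureTheory ProbabilityTheory Finset Filter Set InformationTheory
open scoped BigOperators NNReal ENNReal Topology Matrix
open Literature.Probability.Process Literature.MathematicalPhysics.QuantumFieldTheory
open Literature.MathematicalPhysics.QuantumLattice (fundamentalRep fundamentalLatticeRep continuous_fundamentalRep)

variable {L : ℕ} [NeZero L]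

/-! ## §1. Boundedness of Wilson loops -/

omit [NeZero L] in
/-- `|W_(R×T)(x; i, j)(V)| ≤ 1` for the fundamental representation of `SU(2)` (`|Re tr g| ≤ 2`). [folklore] -/
theorem abs_wilsonLoop_two_le_one (x : Site 3 L) (i j : Fin 3) (R T : ℕ) (V : (GaugeConfig 3 L (Matrix.specialUnitaryGroup (Fin 2) ℂ))) :
    |wilsonLoop (fundamentalRep (Fin 2)) x i j R T V| ≤ 1 := by
  unfold wilsonLoop
  set M : Matrix (Fin 2) (Fin 2) ℂ := fundamentalRep (Fin 2) (rectangleHolonomy V x i j R T) with hM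
  have hMU : M ∈ Matrix.unitaryGroup (Fin 2) ℂ := Literature.MathematicalPhysics.QuantumLattice.fundamentalRep_mem_unitaryGroup _
  have h0 : |(M 0 0).re| ≤ 1 := (Complex.abs_re_le_norm _).trans (entry_norm_bound_of_unitary hMU 0 0)
  have h1 : |(M 1 1).re| ≤ 1 := (Complex.abs_re_le_norm _).trans (entry_norm_bound_of_unitary hMU 1 1)
  have htr : M.trace.re = (M 0 0).re + (M 1 1).re := by
    rw [Matrix.trace_fin_two, Complex.add_re]
  rw [htr, abs_mul, abs_inv, Nat.abs_cast]
  calc ((2 : ℕ) : ℝ)⁻¹ * |(M 0 0).re + (M 1 1).re| ≤ ((2 : ℕ) : ℝ)⁻¹ * (|(M 0 0).re| + |(M 1 1).re|) :=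
        mul_le_mul_of_nonneg_left (abs_add_le _ _) (by positivity)
    _ ≤ ((2 : ℕ) : ℝ)⁻¹ * (1 + 1) := mul_le_mul_of_nonneg_left (add_le_add h0 h1) (by positivity)
    _ = 1 := by norm_num

/-- `|W̄| ≤ 1` for the spatial average `W̄ = (#sites)⁻¹ Σ_x W_(R×T)(x; i, j)`. [folklore] -/
theorem abs_loopAverage_le_one (i j : Fin 3) (R T : ℕ) (V : (GaugeConfig 3 L (Matrix.specialUnitaryGroup (Fin 2) ℂ))) :
    |((Fintype.card (Site 3 L) : ℝ))⁻¹ * ∑ x : Site 3 L, wilsonLoop (fundamentalRep (Fin 2)) x i j R T V| ≤ 1 := by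
  have hS : (0 : ℝ) < (Fintype.card (Site 3 L) : ℝ) := card_site_three_pos L
  rw [abs_mul, abs_inv, abs_of_pos hS]
  calc ((Fintype.card (Site 3 L) : ℝ))⁻¹ * |∑ x : Site 3 L, wilsonLoop (fundamentalRep (Fin 2)) x i j R T V|
      ≤ ((Fintype.card (Site 3 L) : ℝ))⁻¹ * ∑ x : Site 3 L, |wilsonLoop (fundamentalRep (Fin 2)) x i j R T V| :=
        mul_le_mul_of_nonneg_left (Finset.abs_sum_le_sum_abs _ _) (inv_nonneg.2 hS.le)
    _ ≤ ((Fintype.card (Site 3 L) : ℝ))⁻¹ * ∑ _x : Site 3 L, (1 : ℝ) :=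
        mul_le_mul_of_nonneg_left (Finset.sum_le_sum fun x _ => abs_wilsonLoop_two_le_one x i j R T V) (inv_nonneg.2 hS.le)
    _ = 1 := by rw [Finset.sum_const, Finset.card_univ, nsmul_eq_mul, mul_one, inv_mul_cancel₀ hS.ne']

/-! ## §2. The carré du champ of a loop string -/

/-- ★★ **Carré du champ of a loop string**: for a finite family of rectangular loops, the product of the averaged loop functionals (as a function
of the real link coordinates, `c = 1/(2·#sites)`) has `Γ(∏_k W̄_k)(V) ≤ 96·(Σ_k (R_k + T_k))²/#sites` at every configuration.
[cite: ShenZhuZhu2022, §3 Lemma 3.1] -/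
theorem wilson_loopString_carre_le (L : ℕ) [NeZero L] (β' : ℝ) (m : ℕ) (i j : Fin m → Fin 3) (R T : Fin m → ℕ) :
    let coords : GaugeConfig 3 L (Matrix.specialUnitaryGroup (Fin 2) ℂ) → (Edge 3 L × Fin 2 × Fin 2 × Bool → ℝ) :=
      fun V q => (fun z : ℂ => if q.2.2.2 then z.im else z.re)
        ((fundamentalRep (Fin 2) (V q.1) : Matrix (Fin 2) (Fin 2) ℂ) q.2.1 q.2.2.1)
    let A : GaugeConfig 3 L (Matrix.specialUnitaryGroup (Fin 2) ℂ) → (Edge 3 L × Fin 2 × Fin 2 × Bool) →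
        (Edge 3 L × Fin 2 × Fin 2 × Bool) → ℝ := fun V i j =>
      ∑ n : Edge 3 L × NoiseIdx 2,
        (if n.1 = i.1 then (fun z : ℂ => if i.2.2.2 then z.im else z.re)
          ((latticeLangevinDynamics (fundamentalLatticeRep 2) β').noise
            (matrixConfig (fundamentalRep (Fin 2)) V) i.1 n.2 i.2.1 i.2.2.1) else 0) *
        (if n.1 = j.1 then (fun z : ℂ => if j.2.2.2 then z.im else z.re)
          ((latticeLangevinDynamics (fundamentalLatticeRep 2) β').noise
            (matrixConfig (fundamentalRep (Fin 2)) V) j.1 n.2 j.2.1 j.2.2.1) else 0)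
    ∀ V : (GaugeConfig 3 L (Matrix.specialUnitaryGroup (Fin 2) ℂ)),
      (∑ a : Edge 3 L × Fin 2 × Fin 2 × Bool, ∑ b : Edge 3 L × Fin 2 × Fin 2 × Bool,
        fderiv ℝ (fun y => ∏ k : Fin m, (fun y : (Edge 3 L × Fin 2 × Fin 2 × Bool → ℝ) => (2 * (Fintype.card (Site 3 L) : ℝ))⁻¹ * ∑ x : Site 3 L, ((((((List.range (R k)).map (fun m : ℕ => ((Pi.single (i k) ((m : ℕ) : ZMod L) : Site 3 L), (i k), false)) ++ (List.range (T k)).map (fun m : ℕ => ((Pi.single (i k) (((R k) : ℕ) : ZMod L) : Site 3 L) + (Pi.single (j k) ((m : ℕ) : ZMod L) : Site 3 L), (j k), false)) ++ ((List.range (R k)).map (fun m : ℕ => ((Pi.single (j k) (((T k) : ℕ) : ZMod L) : Site 3 L) + (Pi.single (i k) ((m : ℕ) : ZMod L) : Site 3 L), (i k), true))).reverse ++ ((List.range (T k)).map (fun m : ℕ => ((Pi.single (j k) ((m : ℕ) : ZMod L) : Site 3 L), (j k), true))).reverse).map (fun q : Site 3 L × Fin 3 × Bool => ((x + q.1, q.2.1),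 q.2.2))).map (fun a : Edge 3 L × Bool => if a.2 then ((fun (ee : Edge 3 L) => Matrix.of fun (i' j' : Fin 2) => ((y (ee, i', j', false) : ℝ) : ℂ) + ((y (ee, i', j', true) : ℝ) : ℂ) * Complex.I) a.1)ᴴ else (fun (ee : Edge 3 L) => Matrix.of fun (i' j' : Fin 2) => ((y (ee, i', j', false) : ℝ) : ℂ) + ((y (ee, i', j', true) : ℝ) : ℂ) * Complex.I) a.1)).prod)).trace.re) y) (coords V) (Pi.single a 1) *
        fderiv ℝ (fun y => ∏ k : Fin m, (fun y : (Edge 3 L × Fin 2 × Fin 2 × Bool → ℝ) => (2 * (Fintype.card (Site 3 L) : ℝ))⁻¹ * ∑ x : Site 3 L, ((((((List.range (R k)).map (fun m : ℕ => ((Pi.single (i k) ((m : ℕ) : ZMod L) : Site 3 L), (i k), false)) ++ (List.range (T k)).map (fun m : ℕ => ((Pi.single (i k) (((R k) : ℕ) : ZMod L) : Site 3 L) + (Pi.single (j k) ((m : ℕ) : ZMod L) : Site 3 L), (j k), false)) ++ ((List.range (R k)).map (fun m : ℕ => ((Pi.single (j k) (((T k) : ℕ) : ZMod L) : Site 3 L)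 + (Pi.single (i k) ((m : ℕ) : ZMod L) : Site 3 L), (i k), true))).reverse ++ ((List.range (T k)).map (fun m : ℕ => ((Pi.single (j k) ((m : ℕ) : ZMod L) : Site 3 L), (j k), true))).reverse).map (fun q : Site 3 L × Fin 3 × Bool => ((x + q.1, q.2.1), q.2.2))).map (fun a : Edge 3 L × Bool => if a.2 then ((fun (ee : Edge 3 L) => Matrix.of fun (i' j' : Fin 2) => ((y (ee, i', j', false) : ℝ) : ℂ) + ((y (ee, i', j', true) : ℝ) : ℂ) * Complex.I) a.1)ᴴ else (fun (ee : Edge 3 L) => Matrix.of fun (i' j' : Fin 2) => ((y (ee, i', j', false) : ℝ) : ℂ) + ((y (ee, i', j', true) : ℝ) : ℂ) * Complex.I) a.1)).prod)).trace.re) y) (coords V) (Pi.single b 1) * A V a b) ≤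
        96 * (∑ k : Fin m, ((R k : ℝ) + T k)) ^ 2 / (Fintype.card (Site 3 L) : ℝ) := by
  intro coords A V
  classical
  have hS : (0 : ℝ) < (Fintype.card (Site 3 L) : ℝ) := card_site_three_pos L
  set F : Fin m → (Edge 3 L × Fin 2 × Fin 2 × Bool → ℝ) → ℝ := fun k => (fun y : (Edge 3 L × Fin 2 × Fin 2 × Bool → ℝ) => (2 * (Fintype.card (Site 3 L) : ℝ))⁻¹ * ∑ x : Site 3 L, ((((((List.range (R k)).map (fun m : ℕ => ((Pi.single (i k) ((m : ℕ) : ZMod L) : Site 3 L), (i k), false)) ++ (List.range (T k)).map (fun m : ℕ => ((Pi.single (i k) (((R k) : ℕ) : ZMod L) : Site 3 L) + (Pi.single (j k) ((m : ℕ) : ZMod L) : Site 3 L), (j k), false)) ++ ((List.range (R k)).map (fun m : ℕ => ((Pi.single (j k) (((T k) : ℕ) : ZMod L) : Site 3 L) + (Pi.single (i k) ((m : ℕ) : ZMod L) : Site 3 L), (i k), true))).reverse ++ ((List.range (T k)).map (fun m : ℕ => ((Pi.single (j k) ((m : ℕ) : ZMod L) : Site 3 L), (j k), true))).reverse).map (fun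 q : Site 3 L × Fin 3 × Bool => ((x + q.1, q.2.1), q.2.2))).map (fun a : Edge 3 L × Bool => if a.2 then ((fun (ee : Edge 3 L) => Matrix.of fun (i' j' : Fin 2) => ((y (ee, i', j', false) : ℝ) : ℂ) + ((y (ee, i', j', true) : ℝ) : ℂ) * Complex.I) a.1)ᴴ else (fun (ee : Edge 3 L) => Matrix.of fun (i' j' : Fin 2) => ((y (ee, i', j', false) : ℝ) : ℂ) + ((y (ee, i', j', true) : ℝ) : ℂ) * Complex.I) a.1)).prod)).trace.re) with hFdef
  have hF : ∀ k, ContDiff ℝ 1 (F k) := fun k => contDiff_loopAverage _ _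
  have hlen : ∀ k, (((((List.range (R k)).map (fun m : ℕ => ((Pi.single (i k) ((m : ℕ) : ZMod L) : Site 3 L), (i k), false)) ++ (List.range (T k)).map (fun m : ℕ => ((Pi.single (i k) (((R k) : ℕ) : ZMod L) : Site 3 L) + (Pi.single (j k) ((m : ℕ) : ZMod L) : Site 3 L), (j k), false)) ++ ((List.range (R k)).map (fun m : ℕ => ((Pi.single (j k) (((T k) : ℕ) : ZMod L) : Site 3 L) + (Pi.single (i k) ((m : ℕ) : ZMod L) : Site 3 L), (i k), true))).reverse ++ ((List.range (T k)).map (fun m : ℕ => ((Pi.single (j k) ((m : ℕ) : ZMod L) : Site 3 L), (j k), true))).reverse)).length : ℕ) : ℝ) = 2 * ((R k : ℝ) + T k) := by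
    intro k; rw [rectShape_length]; push_cast; ring
  have hval : ∀ k, F k (coords V) = (((Fintype.card (Site 3 L) : ℝ))⁻¹ * ∑ x : Site 3 L, wilsonLoop (fundamentalRep (Fin 2)) x (i k) (j k) (R k) (T k) V) :=
    fun k => loopAverage_coords_eq V (i k) (j k) (R k) (T k)
  have hb : ∀ k, |F k (coords V)| ≤ 1 := fun k => by rw [hval]; exact abs_loopAverage_le_one (i k) (j k) (R k) (T k) V
  set a : Fin m → ℝ := fun k => Real.sqrt (96 / (Fintype.card (Site 3 L) : ℝ)) * ((R k : ℝ) + T k) with hadef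
  have ha : ∀ k, 0 ≤ a k := fun k => by positivity
  have hΓk : ∀ k, (∑ a' : Edge 3 L × Fin 2 × Fin 2 × Bool, ∑ b' : Edge 3 L × Fin 2 × Fin 2 × Bool,
      fderiv ℝ (F k) (coords V) (Pi.single a' 1) * fderiv ℝ (F k) (coords V) (Pi.single b' 1) * A V a' b') ≤ a k ^ 2 := by
    intro k
    have hak : a k ^ 2 = 96 / (Fintype.card (Site 3 L) : ℝ) * ((R k : ℝ) + T k) ^ 2 := by
      simp only [hadef]
      rw [mul_pow, Real.sq_sqrt (by positivity)]
    have h := wilson_loopAverage_carre_le L β' ((List.range (R k)).map (fun m : ℕ => ((Pi.single (i k) ((m : ℕ) : ZMod L) : Site 3 L), (i k), false)) ++ (List.range (T k)).map (fun m : ℕ => ((Pi.single (i k) (((R k) : ℕ) : ZMod L) : Site 3 L) + (Pi.single (j k) ((m : ℕ) : ZMod L) : Site 3 L), (j k), false)) ++ ((List.range (R k)).map (fun m : ℕ => ((Pi.single (j k) (((T k) : ℕ) : ZMod L) : Site 3 L) + (Pi.single (i k) ((m : ℕ) : ZMod L) : Site 3 L), (i k), true))).reverse ++ ((List.range (T k)).map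 (fun m : ℕ => ((Pi.single (j k) ((m : ℕ) : ZMod L) : Site 3 L), (j k), true))).reverse) ((2 * (Fintype.card (Site 3 L) : ℝ))⁻¹) V
    refine h.trans (le_of_eq ?_)
    rw [hlen k, card_edge_eq_three_mul_card_site, hak]
    field_simp
    ring
  have hmain := carre_prod_le L β' m F hF a ha V hb hΓk
  have hsum : (∑ k, a k) ^ 2 = 96 * (∑ k : Fin m, ((R k : ℝ) + T k)) ^ 2 / (Fintype.card (Site 3 L) : ℝ) := by
    simp only [hadef]
    rw [← Finset.mul_sum, mul_pow, Real.sq_sqrt (by positivity)]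
    field_simp
  rw [hsum] at hmain
  exact hmain

/-! ## §3. Cold-start equilibration of loop strings -/

/-- ★★★ **Cold-start equilibration of a loop string, explicit** (`|β'| < 1/12`, `Σ_k(R_k+T_k) > 0`): for every deterministic start, every solution
and every `u ≥ 0`,
`|E ∏_k W̄_k(U_(2+u)) − ∫ ∏_k W̄_k dμ_(β')| ≤ e^(−(1−12|β'|)u)·√(96(Σ_k(R_k+T_k))²·(366|β'|L³ + 3log(3/2)L³ + log 2)/(#sites·(1−12|β'|)))`.
[cite: ShenZhuZhu2022, §4 Theorem 4.2, Corollary 4.4] -/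
theorem wilson_coldStart_loopString_le_exp_explicit (L : ℕ) [NeZero L] (β' : ℝ) (hβ : |β'| < 1 / 12) (m : ℕ) (i j : Fin m → Fin 3)
    (R T : Fin m → ℕ) (hRT : 0 < ∑ k, (R k + T k)) (z : (GaugeConfig 3 L (Matrix.specialUnitaryGroup (Fin 2) ℂ)))
    {Ω : Type} [MeasurableSpace Ω] {P : Measure Ω} [IsProbabilityMeasure P]
    {W : ℝ≥0 → Ω → (Edge 3 L × NoiseIdx 2 → ℝ)} (hW : IsFlatBrownian W P)
    {U : ℝ≥0 → Ω → (GaugeConfig 3 L (Matrix.specialUnitaryGroup (Fin 2) ℂ))} (hU0 : ∀ ω, U 0 ω = z)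
    (hU : (latticeLangevinDynamics (fundamentalLatticeRep 2) β').IsSolution (fundamentalRep (Fin 2)) hW.natFiltration P W U)
    (u : ℝ≥0) :
    |(∫ ω, (∏ k : Fin m, (((Fintype.card (Site 3 L) : ℝ))⁻¹ * ∑ x : Site 3 L, wilsonLoop (fundamentalRep (Fin 2)) x (i k) (j k) (R k) (T k) (U ((2 : ℝ≥0) + u) ω))) ∂P) - ∫ V, (∏ k : Fin m, (((Fintype.card (Site 3 L) : ℝ))⁻¹ * ∑ x : Site 3 L, wilsonLoop (fundamentalRep (Fin 2)) x (i k) (j k) (R k) (T k) V)) ∂(wilsonMeasure (d := 3) (L := L) (fundamentalRep (Fin 2)) β')| ≤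
      Real.exp (-(1 - 12 * |β'|) * u) * Real.sqrt (96 * (∑ k : Fin m, ((R k : ℝ) + T k)) ^ 2 * (366 * |β'| * (L : ℝ) ^ 3 + 3 * Real.log (3 / 2) * (L : ℝ) ^ 3 + Real.log 2) / ((Fintype.card (Site 3 L) : ℝ) * (1 - 12 * |β'|))) := by
  classical
  haveI := secondCountableTopology_su2
  haveI := borelSpace_config L
  set μ : Measure (GaugeConfig 3 L (Matrix.specialUnitaryGroup (Fin 2) ℂ)) := (wilsonMeasure (d := 3) (L := L) (fundamentalRep (Fin 2)) β') with hμ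
  haveI : IsProbabilityMeasure μ :=
    isProbabilityMeasure_wilsonMeasure (d := 3) (L := L) (fundamentalRep (Fin 2)) (continuous_fundamentalRep (Fin 2)) β'
  have hρ : 0 < 1 - 12 * |β'| := by linarith
  have hS : (0 : ℝ) < (Fintype.card (Site 3 L) : ℝ) := card_site_three_pos L
  have hRT' : (0 : ℝ) < (∑ k : Fin m, ((R k : ℝ) + T k)) := by
    have h : ((∑ k, (R k + T k) : ℕ) : ℝ) = (∑ k : Fin m, ((R k : ℝ) + T k)) := by push_cast; rfl
    rw [← h]; exact_mod_cast hRT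
  set co : (GaugeConfig 3 L (Matrix.specialUnitaryGroup (Fin 2) ℂ)) → (Edge 3 L × Fin 2 × Fin 2 × Bool → ℝ) := (fun (V : GaugeConfig 3 L (Matrix.specialUnitaryGroup (Fin 2) ℂ)) (q : Edge 3 L × Fin 2 × Fin 2 × Bool) => (fun z : ℂ => if q.2.2.2 then z.im else z.re) ((fundamentalRep (Fin 2) (V q.1) : Matrix (Fin 2) (Fin 2) ℂ) q.2.1 q.2.2.1)) with hco
  set F : Fin m → (Edge 3 L × Fin 2 × Fin 2 × Bool → ℝ) → ℝ := fun k => (fun y : (Edge 3 L × Fin 2 × Fin 2 × Bool → ℝ) => (2 * (Fintype.card (Site 3 L) : ℝ))⁻¹ * ∑ x : Site 3 L, ((((((List.range (R k)).map (fun m : ℕ => ((Pi.single (i k) ((m : ℕ) : ZMod L) : Site 3 L), (i k), false)) ++ (List.range (T k)).map (fun m : ℕ => ((Pi.single (i k) (((R k) : ℕ) : ZMod L) : Site 3 L) + (Pi.single (j k) ((m : ℕ) : ZMod L) : Site 3 L), (j k), false)) ++ ((List.range (R k)).map (fun m : ℕ => ((Pi.single (j k) (((T k) : ℕ) : ZMod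 L) : Site 3 L) + (Pi.single (i k) ((m : ℕ) : ZMod L) : Site 3 L), (i k), true))).reverse ++ ((List.range (T k)).map (fun m : ℕ => ((Pi.single (j k) ((m : ℕ) : ZMod L) : Site 3 L), (j k), true))).reverse).map (fun q : Site 3 L × Fin 3 × Bool => ((x + q.1, q.2.1), q.2.2))).map (fun a : Edge 3 L × Bool => if a.2 then ((fun (ee : Edge 3 L) => Matrix.of fun (i' j' : Fin 2) => ((y (ee, i', j', false) : ℝ) : ℂ) + ((y (ee, i', j', true) : ℝ) : ℂ) * Complex.I) a.1)ᴴ else (fun (ee : Edge 3 L) => Matrix.of fun (i' j' : Fin 2) => ((y (ee, i', j', false) : ℝ) : ℂ) + ((y (ee, i', j', true) : ℝ) : ℂ) * Complex.I) a.1)).prod)).trace.re) with hFdef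
  have hfC : ContDiff ℝ 3 (fun y => ∏ k : Fin m, F k y) := contDiff_prod (fun k _ => contDiff_loopAverage _ _)
  have hval : ∀ (k) (V : (GaugeConfig 3 L (Matrix.specialUnitaryGroup (Fin 2) ℂ))), F k (co V) = (((Fintype.card (Site 3 L) : ℝ))⁻¹ * ∑ x : Site 3 L, wilsonLoop (fundamentalRep (Fin 2)) x (i k) (j k) (R k) (T k) V) :=
    fun k V => loopAverage_coords_eq V (i k) (j k) (R k) (T k)
  have hvalP : ∀ V : (GaugeConfig 3 L (Matrix.specialUnitaryGroup (Fin 2) ℂ)), (fun y => ∏ k : Fin m, F k y) (co V) = (∏ k : Fin m, (((Fintype.card (Site 3 L) : ℝ))⁻¹ * ∑ x : Site 3 L, wilsonLoop (fundamentalRep (Fin 2)) x (i k) (j k) (R k) (T k) V)) :=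
    fun V => Finset.prod_congr rfl fun k _ => hval k V
  have hs : 0 < 96 * (∑ k : Fin m, ((R k : ℝ) + T k)) ^ 2 / (Fintype.card (Site 3 L) : ℝ) := by positivity
  have hmain : |(∫ ω, (fun y => ∏ k : Fin m, F k y) (co (U ((2 : ℝ≥0) + u) ω)) ∂P) - ∫ V, (fun y => ∏ k : Fin m, F k y) (co V) ∂μ| ≤
      Real.exp (-(1 - 12 * |β'|) * u) * Real.sqrt ((96 * (∑ k : Fin m, ((R k : ℝ) + T k)) ^ 2 / (Fintype.card (Site 3 L) : ℝ)) * (366 * |β'| * (L : ℝ) ^ 3 + 3 * Real.log (3 / 2) * (L : ℝ) ^ 3 + Real.log 2) / (1 - 12 * |β'|)) :=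
    wilson_coldStart_smooth_le_exp_explicit L β' hβ (fun y => ∏ k : Fin m, F k y) hfC hs hW z hU0 hU u (wilson_loopString_carre_le L β' m i j R T)
  have hEP : ∫ ω, (fun y => ∏ k : Fin m, F k y) (co (U ((2 : ℝ≥0) + u) ω)) ∂P = ∫ ω, (∏ k : Fin m, (((Fintype.card (Site 3 L) : ℝ))⁻¹ * ∑ x : Site 3 L, wilsonLoop (fundamentalRep (Fin 2)) x (i k) (j k) (R k) (T k) (U ((2 : ℝ≥0) + u) ω))) ∂P :=
    integral_congr_ae (ae_of_all _ fun ω => hvalP _)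
  have hEμ : ∫ V, (fun y => ∏ k : Fin m, F k y) (co V) ∂μ = ∫ V, (∏ k : Fin m, (((Fintype.card (Site 3 L) : ℝ))⁻¹ * ∑ x : Site 3 L, wilsonLoop (fundamentalRep (Fin 2)) x (i k) (j k) (R k) (T k) V)) ∂μ :=
    integral_congr_ae (ae_of_all _ fun V => hvalP V)
  have e2 : (96 * (∑ k : Fin m, ((R k : ℝ) + T k)) ^ 2 / (Fintype.card (Site 3 L) : ℝ)) * (366 * |β'| * (L : ℝ) ^ 3 + 3 * Real.log (3 / 2) * (L : ℝ) ^ 3 + Real.log 2) / (1 - 12 * |β'|) =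
      96 * (∑ k : Fin m, ((R k : ℝ) + T k)) ^ 2 * (366 * |β'| * (L : ℝ) ^ 3 + 3 * Real.log (3 / 2) * (L : ℝ) ^ 3 + Real.log 2) / ((Fintype.card (Site 3 L) : ℝ) * (1 - 12 * |β'|)) := by
    field_simp
  rw [hEP, hEμ, e2] at hmain
  exact hmain

/-- ★★★ **VOLUME-FREE cold-start equilibration of loop strings** (`|β'| < 1/12`, `ρ = 1 − 12|β'|`, `Σ_k(R_k+T_k) > 0`): for EVERY `L`, every
deterministic start, every solution and every `u ≥ 0`, `|E ∏_k W̄_k(U_(2+u)) − ∫ ∏_k W̄_k dμ_(β')| ≤ 57·(Σ_k(R_k+T_k))·e^(−ρu)/√ρ`.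
[cite: ShenZhuZhu2022, §4 Theorem 4.2, Corollary 4.4] -/
theorem wilson_coldStart_loopString_le_volumeFree (L : ℕ) [NeZero L] (β' : ℝ) (hβ : |β'| < 1 / 12) (m : ℕ) (i j : Fin m → Fin 3)
    (R T : Fin m → ℕ) (hRT : 0 < ∑ k, (R k + T k)) (z : (GaugeConfig 3 L (Matrix.specialUnitaryGroup (Fin 2) ℂ)))
    {Ω : Type} [MeasurableSpace Ω] {P : Measure Ω} [IsProbabilityMeasure P]
    {W : ℝ≥0 → Ω → (Edge 3 L × NoiseIdx 2 → ℝ)} (hW : IsFlatBrownian W P)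
    {U : ℝ≥0 → Ω → (GaugeConfig 3 L (Matrix.specialUnitaryGroup (Fin 2) ℂ))} (hU0 : ∀ ω, U 0 ω = z)
    (hU : (latticeLangevinDynamics (fundamentalLatticeRep 2) β').IsSolution (fundamentalRep (Fin 2)) hW.natFiltration P W U)
    (u : ℝ≥0) :
    |(∫ ω, (∏ k : Fin m, (((Fintype.card (Site 3 L) : ℝ))⁻¹ * ∑ x : Site 3 L, wilsonLoop (fundamentalRep (Fin 2)) x (i k) (j k) (R k) (T k) (U ((2 : ℝ≥0) + u) ω))) ∂P) - ∫ V, (∏ k : Fin m, (((Fintype.card (Site 3 L) : ℝ))⁻¹ * ∑ x : Site 3 L, wilsonLoop (fundamentalRep (Fin 2)) x (i k) (j k) (R k) (T k) V)) ∂(wilsonMeasure (d := 3) (L := L) (fundamentalRep (Fin 2)) β')| ≤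
      57 * (∑ k : Fin m, ((R k : ℝ) + T k)) * Real.exp (-(1 - 12 * |β'|) * u) / Real.sqrt (1 - 12 * |β'|) := by
  have hρ : 0 < 1 - 12 * |β'| := by linarith
  have hRT' : (0 : ℝ) < (∑ k : Fin m, ((R k : ℝ) + T k)) := by
    have h : ((∑ k, (R k + T k) : ℕ) : ℝ) = (∑ k : Fin m, ((R k : ℝ) + T k)) := by push_cast; rfl
    rw [← h]; exact_mod_cast hRT
  have h := wilson_coldStart_loopString_le_exp_explicit L β' hβ m i j R T hRT z hW hU0 hU u
  refine h.trans ?_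
  have hSite : (Fintype.card (Site 3 L) : ℝ) = (L : ℝ) ^ 3 := by
    rw [card_site_three]; push_cast; ring
  have hL30 : (0 : ℝ) < (L : ℝ) ^ 3 := by
    have hL : 0 < L := Nat.pos_of_ne_zero (NeZero.ne L)
    positivity
  have hB := burnInBudget_le_volume L β' hβ
  obtain ⟨S, hSdef⟩ : ∃ S : ℝ, (∑ k : Fin m, ((R k : ℝ) + T k)) = S := ⟨_, rfl⟩
  rw [hSdef] at hRT' ⊢
  have hq : 96 * S ^ 2 * (366 * |β'| * (L : ℝ) ^ 3 + 3 * Real.log (3 / 2) * (L : ℝ) ^ 3 + Real.log 2) / ((Fintype.card (Site 3 L) : ℝ) * (1 - 12 * |β'|)) ≤ (57 * S / Real.sqrt (1 - 12 * |β'|)) ^ 2 := by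
    rw [div_pow, Real.sq_sqrt hρ.le, hSite, div_le_div_iff₀ (by positivity) hρ]
    have hS2 : 0 < S ^ 2 := by positivity
    nlinarith [mul_le_mul_of_nonneg_left hB (le_of_lt (mul_pos hS2 hρ)), mul_pos (mul_pos hS2 hρ) hL30]
  have hsq : Real.sqrt (96 * S ^ 2 * (366 * |β'| * (L : ℝ) ^ 3 + 3 * Real.log (3 / 2) * (L : ℝ) ^ 3 + Real.log 2) / ((Fintype.card (Site 3 L) : ℝ) * (1 - 12 * |β'|))) ≤ 57 * S / Real.sqrt (1 - 12 * |β'|) :=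
    (Real.sqrt_le_sqrt hq).trans (le_of_eq (Real.sqrt_sq (by positivity)))
  calc Real.exp (-(1 - 12 * |β'|) * u) * Real.sqrt (96 * S ^ 2 * (366 * |β'| * (L : ℝ) ^ 3 + 3 * Real.log (3 / 2) * (L : ℝ) ^ 3 + Real.log 2) / ((Fintype.card (Site 3 L) : ℝ) * (1 - 12 * |β'|)))
      ≤ Real.exp (-(1 - 12 * |β'|) * u) * (57 * S / Real.sqrt (1 - 12 * |β'|)) := mul_le_mul_of_nonneg_left hsq (Real.exp_pos _).le
    _ = 57 * S * Real.exp (-(1 - 12 * |β'|) * u) / Real.sqrt (1 - 12 * |β'|) := by ring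

/-- ★★★ **VOLUME-INDEPENDENT equilibration time of loop strings** (`|β'| < 1/12`, `ρ = 1 − 12|β'|`, `Σ_k(R_k+T_k) > 0`): for every `ε > 0` and
every `u ≥ log(57Σ_k(R_k+T_k)/(ε√ρ))/ρ`, every `L`, every deterministic start and every solution,
`|E ∏_k W̄_k(U_(2+u)) − ∫ ∏_k W̄_k dμ_(β')| ≤ ε`. [cite: ShenZhuZhu2022, §4 Theorem 4.2, Corollary 4.4] -/
theorem wilson_coldStart_loopString_mixingTime_volumeFree (L : ℕ) [NeZero L] (β' : ℝ) (hβ : |β'| < 1 / 12) (m : ℕ) (i j : Fin m → Fin 3)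
    (R T : Fin m → ℕ) (hRT : 0 < ∑ k, (R k + T k)) (z : (GaugeConfig 3 L (Matrix.specialUnitaryGroup (Fin 2) ℂ)))
    {Ω : Type} [MeasurableSpace Ω] {P : Measure Ω} [IsProbabilityMeasure P]
    {W : ℝ≥0 → Ω → (Edge 3 L × NoiseIdx 2 → ℝ)} (hW : IsFlatBrownian W P)
    {U : ℝ≥0 → Ω → (GaugeConfig 3 L (Matrix.specialUnitaryGroup (Fin 2) ℂ))} (hU0 : ∀ ω, U 0 ω = z)
    (hU : (latticeLangevinDynamics (fundamentalLatticeRep 2) β').IsSolution (fundamentalRep (Fin 2)) hW.natFiltration P W U)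
    {ε : ℝ} (hε : 0 < ε) (u : ℝ≥0) (hu : Real.log (57 * (∑ k : Fin m, ((R k : ℝ) + T k)) / (ε * Real.sqrt (1 - 12 * |β'|))) / (1 - 12 * |β'|) ≤ (u : ℝ)) :
    |(∫ ω, (∏ k : Fin m, (((Fintype.card (Site 3 L) : ℝ))⁻¹ * ∑ x : Site 3 L, wilsonLoop (fundamentalRep (Fin 2)) x (i k) (j k) (R k) (T k) (U ((2 : ℝ≥0) + u) ω))) ∂P) - ∫ V, (∏ k : Fin m, (((Fintype.card (Site 3 L) : ℝ))⁻¹ * ∑ x : Site 3 L, wilsonLoop (fundamentalRep (Fin 2)) x (i k) (j k) (R k) (T k) V)) ∂(wilsonMeasure (d := 3) (L := L) (fundamentalRep (Fin 2)) β')| ≤ ε := by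
  have hρ : 0 < 1 - 12 * |β'| := by linarith
  have hsρ : 0 < Real.sqrt (1 - 12 * |β'|) := Real.sqrt_pos.2 hρ
  have hRT' : (0 : ℝ) < (∑ k : Fin m, ((R k : ℝ) + T k)) := by
    have h : ((∑ k, (R k + T k) : ℕ) : ℝ) = (∑ k : Fin m, ((R k : ℝ) + T k)) := by push_cast; rfl
    rw [← h]; exact_mod_cast hRT
  have h := wilson_coldStart_loopString_le_volumeFree L β' hβ m i j R T hRT z hW hU0 hU u
  refine h.trans ?_
  obtain ⟨S, hSdef⟩ : ∃ S : ℝ, (∑ k : Fin m, ((R k : ℝ) + T k)) = S := ⟨_, rfl⟩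
  rw [hSdef] at hRT' hu ⊢
  have hu' : Real.log (57 * S / (ε * Real.sqrt (1 - 12 * |β'|))) ≤ (1 - 12 * |β'|) * u := by
    rw [div_le_iff₀ hρ] at hu
    linarith
  have hexp : Real.exp (-(1 - 12 * |β'|) * u) ≤ (ε * Real.sqrt (1 - 12 * |β'|)) / (57 * S) := by
    have h1 : Real.exp (-(1 - 12 * |β'|) * u) ≤ Real.exp (-Real.log (57 * S / (ε * Real.sqrt (1 - 12 * |β'|)))) := Real.exp_le_exp.2 (by linarith)
    rw [Real.exp_neg, Real.exp_log (by positivity), inv_div] at h1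
    exact h1
  calc 57 * S * Real.exp (-(1 - 12 * |β'|) * u) / Real.sqrt (1 - 12 * |β'|)
      ≤ 57 * S * ((ε * Real.sqrt (1 - 12 * |β'|)) / (57 * S)) / Real.sqrt (1 - 12 * |β'|) :=
        div_le_div_of_nonneg_right (mul_le_mul_of_nonneg_left hexp (by positivity)) hsρ.le
    _ = ε := by field_simp

end Summit.QuantumFields.YangMills.Theorems.ColdStartUniversality
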